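import Mathlib.RingTheory.Finiteness.Nakayama
import Mathlib.Algebra.Algebra.Subalgebra.Lattice
import Mathlib.LinearAlgebra.FiniteDimensional.Lemmas
import Mathlib.RingTheory.Noetherian.Basic
import Mathlib.LinearAlgebra.Quotient.Basic
import Mathlib.Algebra.Exact.Basic
import HarnessLib

/-!
# Lifting simultaneous eigenvectors from quotients (the Ash–Stevens lemma)

Topic `LinearAlgebra`; theorems only (no definition, no named fact).

Let `V` be a finite-dimensional vector space over a field `F`, `(T i)_{i ∈ ι}` a family of
pairwise COMMUTING endomorphisms (any index set), `a : ι → F` a "system of eigenvalues", and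
`W ≤ V` a subspace stable under every `T i`.  The main result,
`exists_forall_apply_eq_smul_of_forall_sub_smul_mem`, says:

*if the system `a` occurs in the quotient `V / W` — there is `v ∉ W` with `T i v - a i v ∈ W` for
all `i` — then it occurs in `V`: there is `u ≠ 0` with `T i u = a i u` for all `i`.*

Hence (`exists_forall_apply_eq_smul_iff`) a system of eigenvalues occurs in `V` iff it occurs in
`W` or in `V / W`, and by induction it occurs in `V` iff it occurs in some subquotient of any
`T`-stable filtration ("dévissage"); `exists_forall_apply_eq_smul_of_exact` is the form for an
exact sequence `V₁ → V₂ → V₃` (a system occurring in `V₂` occurs in `V₁` or `V₃`), the shape used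
along long exact sequences in cohomology.  This is the linear algebra known in the theory of Hecke
operators on the cohomology of arithmetic groups as the **Ash–Stevens lemma** (A. Ash, G. Stevens,
*Cohomology of arithmetic groups and congruences between systems of Hecke eigenvalues*, J. reine
angew. Math. 365 (1986), §1: a system of Hecke eigenvalues occurring in a subquotient of a
finite-dimensional Hecke module occurs in the module; in the form "a system of eigenvalues occurs in
an `ℋ`-module `V` iff `V_𝔪 ≠ 0`" it is used e.g. by Herzig, Duke Math. J. 149 (2009), §10), and it
is the mechanism of the step "lifting eigencharacters along exact sequences" (§3, Lemmas 3.1–3.3) of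
A. Ash, *Smith theory and Hecke operators*, J. Algebra 259 (2003) [Ash2003], whose main theorem is
the tree's named fact `Literature.NumberTheory.Automorphic.Ash2003_inducedRayClassCharacter_attached`.
Commutativity cannot be dropped (`T₁ = E₁₂`, `T₂ = E₂₁` on `F²`, `W = F e₁`, `a = 0`), nor finite
dimension (the shift on `F[X]`, `W = X F[X]`).

## Proof

Replace `T i` by `T i - a i`, so that eigenvectors are common zeros.  Let `A ⊆ End_F V` be the
(commutative, finite-dimensional) subalgebra generated by the `T i` and `J ⊆ A` the ideal they
generate.  The chain `J^k V` of subspaces stabilises, `J · J^N V = J^N V`, so by Nakayama's lemma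
(Mathlib `Submodule.exists_sub_one_mem_and_smul_eq_zero_of_fg_of_le_smul`) some `x ∈ J` acts as the
identity on `J^N V`.  The kernel `U` of `x^N` is an `A`-submodule killed by `J^N` (for `u ∈ U`,
`J^N u ⊆ J^N V` on which `x^N` is both `0` and the identity); if `U ≠ 0`, the last nonzero `J^k U`
consists of common zeros (`exists_ne_zero_forall_smul_eq_zero`).  Otherwise `x^N` is injective, hence
onto `J^N V = V`, so `x` is the identity on `V`; but `x ∈ J` maps the given `v ∉ W` into `W`
(`T i v ∈ W` and `W` is `A`-stable) — contradiction.

## References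

* A. Ash, G. Stevens, *Cohomology of arithmetic groups and congruences between systems of Hecke
  eigenvalues*, J. reine angew. Math. 365 (1986), 192–220, §1 (the lifting lemma; not held).
* A. Ash, *Smith theory and Hecke operators*, J. Algebra 259 (2003) 43–58, §3, Lemmas 3.1–3.3
  [Ash2003].
* F. Herzig, *The weight in a Serre-type conjecture for tame `n`-dimensional Galois
  representations*, Duke Math. J. 149 (2009), §10 (proof after (10.15)).
-/

open Module

namespace Literature.LinearAlgebra

/-! ### A nilpotent ideal action has a common zero -/

/-- If an ideal `J` acts nilpotently on a nonzero submodule `U` (`J^N U = 0`), then `U` contains a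
nonzero element killed by `J` (any nonzero element of the last nonzero `J^k U`). [folklore] -/
theorem exists_ne_zero_forall_smul_eq_zero {R M : Type*} [CommRing R] [AddCommGroup M] [Module R M]
    {J : Ideal R} {U : Submodule R M} (hU : U ≠ ⊥) (hN : ∃ N : ℕ, J ^ N • U = ⊥) :
    ∃ u ∈ U, u ≠ 0 ∧ ∀ y ∈ J, y • u = 0 := by
  classical
  have h0 : Nat.find hN ≠ 0 := by
    intro h
    have h1 := Nat.find_spec hN
    rw [h, pow_zero, Ideal.one_eq_top, Submodule.top_smul] at h1
    exact hU h1
  obtain ⟨k, hk⟩ := Nat.exists_eq_add_one_of_ne_zero h0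
  have hk' : ¬ J ^ k • U = ⊥ := Nat.find_min hN (by rw [hk]; exact Nat.lt_succ_self k)
  obtain ⟨u, hu, hu0⟩ := (Submodule.ne_bot_iff _).1 hk'
  refine ⟨u, Submodule.smul_le_right hu, hu0, fun y hy => ?_⟩
  have hmem : y • u ∈ J ^ (k + 1) • U := by
    rw [pow_succ', Submodule.mul_smul]
    exact Submodule.smul_mem_smul hy hu
  rw [← hk, Nat.find_spec hN] at hmem
  exact (Submodule.mem_bot R).1 hmem

/-! ### The lifting lemma -/

section Lifting

variable {F V : Type*} [Field F] [AddCommGroup V] [Module F V] [FiniteDimensional F V]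
variable {ι : Type*}

open scoped IsMulCommutative in
/-- **Lifting simultaneous eigenvectors from a quotient (Ash–Stevens lemma).**  Let `T i` (`i ∈ ι`)
be pairwise commuting endomorphisms of a finite-dimensional vector space `V`, `a : ι → F`, and `W` a
subspace stable under all `T i`.  If some `v ∉ W` satisfies `T i v - a i • v ∈ W` for every `i` (the
system of eigenvalues `a` occurs in `V / W`), then there is `u ≠ 0` in `V` with `T i u = a i • u`
for every `i` (it occurs in `V`).  See the module docstring for the proof (Nakayama's lemma for the
ideal generated by the `T i - a i` in the commutative algebra they generate). [folklore] -/
theorem exists_forall_apply_eq_smul_of_forall_sub_smul_mem (T : ι → Module.End F V)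
    (hT : ∀ i j, Commute (T i) (T j)) (a : ι → F) {W : Submodule F V}
    (hW : ∀ i, ∀ w ∈ W, T i w ∈ W) (h : ∃ v : V, v ∉ W ∧ ∀ i, T i v - a i • v ∈ W) :
    ∃ u : V, u ≠ 0 ∧ ∀ i, T i u = a i • u := by
  classical
  -- the shifted operators `T' i = T i - a i`, still commuting and preserving `W`
  set T' : ι → Module.End F V := fun i => T i - a i • (1 : Module.End F V) with hT'
  have hT'apply : ∀ i (v : V), T' i v = T i v - a i • v := fun i v => by
    simp [hT']
  have hc : ∀ i j, Commute (T' i) (T' j) := fun i j => by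
    have h1 : Commute (T i) (T' j) := (hT i j).sub_right ((Commute.one_right (T i)).smul_right (a j))
    have h2 : Commute (a i • (1 : Module.End F V)) (T' j) := (Commute.one_left (T' j)).smul_left (a i)
    exact h1.sub_left h2
  have hcomm : ∀ x ∈ Set.range T', ∀ y ∈ Set.range T', x * y = y * x := by
    rintro _ ⟨i, rfl⟩ _ ⟨j, rfl⟩
    exact (hc i j).eq
  have hWT' : ∀ i, ∀ w ∈ W, T' i w ∈ W := fun i w hw => by
    rw [hT'apply]
    exact W.sub_mem (hW i w hw) (W.smul_mem _ hw)
  -- the commutative subalgebra `A` generated by the `T' i`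
  set A : Subalgebra F (Module.End F V) := Algebra.adjoin F (Set.range T') with hA
  haveI : IsMulCommutative A := Algebra.isMulCommutative_adjoin F hcomm
  -- `W` is `A`-stable
  have hWA : ∀ y : A, ∀ w ∈ W, (y : Module.End F V) w ∈ W := by
    rintro ⟨y, hy⟩
    induction hy using Algebra.adjoin_induction with
    | mem x hx =>
      obtain ⟨i, rfl⟩ := hx
      exact hWT' i
    | algebraMap r =>
      intro w hw
      rw [Module.algebraMap_end_apply]
      exact W.smul_mem r hw
    | add x y _ _ ihx ihy =>
      intro w hw
      rw [LinearMap.add_apply]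
      exact W.add_mem (ihx w hw) (ihy w hw)
    | mul x y _ _ ihx ihy =>
      intro w hw
      rw [Module.End.mul_apply]
      exact ihx _ (ihy w hw)
  -- the generators and the ideal `J` they generate
  set t : ι → A := fun i => ⟨T' i, Algebra.subset_adjoin (Set.mem_range_self i)⟩ with ht
  set J : Ideal A := Ideal.span (Set.range t) with hJ
  have hsmul : ∀ (y : A) (v : V), y • v = (y : Module.End F V) v := fun y v => rfl
  -- the chain `J^k V` stabilises
  set P : ℕ → Submodule A V := fun k => J ^ k • ⊤ with hP
  have hPanti : ∀ k, P (k + 1) ≤ P k := fun k =>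
    Submodule.smul_mono_left (Ideal.pow_le_pow_right (Nat.le_succ k))
  have hex : ∃ N, P (N + 1) = P N := by
    by_contra hne
    push Not at hne
    have hstrict : ∀ k, Module.finrank F ((P (k + 1)).restrictScalars F) <
        Module.finrank F ((P k).restrictScalars F) := fun k => by
      refine Submodule.finrank_lt_finrank_of_lt (lt_of_le_of_ne ?_ fun heq => hne k ?_)
      · exact fun v hv => hPanti k hv
      · exact Submodule.restrictScalars_injective F _ _ heq
    have hle : ∀ k, Module.finrank F ((P k).restrictScalars F) + k ≤ Module.finrank F V := by
      intro k
      induction k with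
      | zero => simpa using Submodule.finrank_le ((P 0).restrictScalars F)
      | succ k ih => have := hstrict k; omega
    have := hle (Module.finrank F V + 1)
    omega
  obtain ⟨N, hN⟩ := hex
  have hJP : J • P N = P N := by
    have h1 : P (N + 1) = J • P N := by
      simp only [hP, pow_succ', Submodule.mul_smul]
    rw [← h1, hN]
  -- Nakayama: some `x ∈ J` is the identity on `P N = J^N V`
  haveI : IsNoetherian A V := isNoetherian_of_tower F (inferInstance : IsNoetherian F V)
  have hfg : (P N).FG := IsNoetherian.noetherian _
  obtain ⟨r, hr1, hr⟩ :=
    Submodule.exists_sub_one_mem_and_smul_eq_zero_of_fg_of_le_smul J (P N) hfg hJP.ge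
  set x : A := 1 - r with hx
  have hxJ : x ∈ J := by
    rw [hx, ← neg_sub]
    exact J.neg_mem hr1
  have hxP : ∀ n ∈ P N, x • n = n := fun n hn => by
    rw [hx, sub_smul, one_smul, hr n hn, sub_zero]
  have hxpow : ∀ (k : ℕ), ∀ n ∈ P N, (x ^ k) • n = n := by
    intro k
    induction k with
    | zero => intro n _; rw [pow_zero, one_smul]
    | succ k ih => intro n hn; rw [pow_succ, mul_smul, hxP n hn, ih n hn]
  -- suppose there is no common eigenvector
  by_contra hno
  push Not at hno
  -- `x^N` maps `V` into `P N` and is the identity there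
  have hm_mem : ∀ v : V, (x ^ N) • v ∈ P N := fun v =>
    Submodule.smul_mem_smul (Ideal.pow_mem_pow hxJ N) (Submodule.mem_top : v ∈ (⊤ : Submodule A V))
  -- the kernel `U` of `x^N` is killed by `J^N`
  set U : Submodule A V := LinearMap.ker (LinearMap.lsmul A V (x ^ N)) with hU
  have hU_mem : ∀ v : V, v ∈ U ↔ (x ^ N) • v = 0 := fun v => by
    rw [hU, LinearMap.mem_ker, LinearMap.lsmul_apply]
  have hJU : ∀ y ∈ J ^ N, ∀ u ∈ U, y • u = 0 := fun y hy u hu => by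
    have h1 : y • u ∈ P N := Submodule.smul_mem_smul hy (Submodule.mem_top : u ∈ (⊤ : Submodule A V))
    have h2 : (x ^ N) • (y • u) = 0 := by
      rw [smul_smul, mul_comm, ← smul_smul, (hU_mem u).1 hu, smul_zero]
    rw [← hxpow N _ h1]
    exact h2
  -- `U = 0`, since a nonzero `U` would contain a common zero of the `T' i`
  have hUbot : U = ⊥ := by
    by_contra hne
    obtain ⟨u, -, hu0, hu⟩ := exists_ne_zero_forall_smul_eq_zero (J := J) (U := U) hne ⟨N, by
      rw [eq_bot_iff]
      refine Submodule.smul_le.2 fun y hy u hu => ?_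
      rw [hJU y hy u hu]
      exact Submodule.zero_mem _⟩
    obtain ⟨i, hi⟩ := hno u hu0
    apply hi
    have h1 := hu (t i) (Ideal.subset_span (Set.mem_range_self i))
    rw [hsmul] at h1
    change T' i u = 0 at h1
    rwa [hT'apply, sub_eq_zero] at h1
  -- hence `x^N` is injective, so onto `P N = V`, and `x` is the identity on `V`
  have hinj : Function.Injective ((x ^ N : A) : Module.End F V) := by
    intro v w hvw
    have h1 : v - w ∈ U := (hU_mem _).2 (by rw [smul_sub, sub_eq_zero]; exact hvw)
    rw [hUbot, Submodule.mem_bot, sub_eq_zero] at h1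
    exact h1
  have hsurj : Function.Surjective ((x ^ N : A) : Module.End F V) :=
    LinearMap.surjective_of_injective hinj
  have htop : ∀ v : V, v ∈ P N := fun v => by
    obtain ⟨w, rfl⟩ := hsurj v
    exact hm_mem w
  have hxid : ∀ v : V, (x : Module.End F V) v = v := fun v => hxP v (htop v)
  -- but `x ∈ J` maps the given `v ∉ W` into `W`
  obtain ⟨v, hvW, hv⟩ := h
  have hJv : ∀ y ∈ J, (y : Module.End F V) v ∈ W := by
    intro y hy
    refine Submodule.span_induction (p := fun (y : A) _ => (y : Module.End F V) v ∈ W) ?_ ?_ ?_ ?_ hy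
    · rintro _ ⟨i, rfl⟩
      change T' i v ∈ W
      rw [hT'apply]
      exact hv i
    · exact (by simp : ((0 : A) : Module.End F V) v ∈ W)
    · intro y z _ _ hy hz
      exact (by simpa using W.add_mem hy hz : ((y + z : A) : Module.End F V) v ∈ W)
    · intro c y _ hy
      exact (by simpa using hWA c _ hy : ((c • y : A) : Module.End F V) v ∈ W)
  exact hvW (by simpa [hxid v] using hJv x hxJ)

/-- **A system of eigenvalues occurs in `V` iff it occurs in `W` or in `V / W`** (for commuting
`T i` preserving the subspace `W` of the finite-dimensional `V`): the equivalence form of the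
Ash–Stevens lemma; by induction a system of eigenvalues occurs in `V` iff it occurs in some
subquotient of any `T`-stable filtration ("dévissage"). [folklore] -/
theorem exists_forall_apply_eq_smul_iff (T : ι → Module.End F V) (hT : ∀ i j, Commute (T i) (T j))
    (a : ι → F) {W : Submodule F V} (hW : ∀ i, ∀ w ∈ W, T i w ∈ W) :
    (∃ u : V, u ≠ 0 ∧ ∀ i, T i u = a i • u) ↔
      (∃ w ∈ W, w ≠ 0 ∧ ∀ i, T i w = a i • w) ∨ (∃ v : V, v ∉ W ∧ ∀ i, T i v - a i • v ∈ W) := by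
  constructor
  · rintro ⟨u, hu0, hu⟩
    by_cases huW : u ∈ W
    · exact Or.inl ⟨u, huW, hu0, hu⟩
    · exact Or.inr ⟨u, huW, fun i => by rw [hu i, sub_self]; exact W.zero_mem⟩
  · rintro (⟨w, -, hw0, hw⟩ | h)
    · exact ⟨w, hw0, hw⟩
    · exact exists_forall_apply_eq_smul_of_forall_sub_smul_mem T hT a hW h

/-- The lifting lemma in terms of the quotient module `V ⧸ W` and the induced endomorphisms
`Submodule.mapQ`: a common eigenvector of the `T̄ i` in `V ⧸ W` with eigenvalues `a` lifts to a common
eigenvector of the `T i` in `V` with the same eigenvalues. [folklore] -/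
theorem exists_forall_apply_eq_smul_of_quotient (T : ι → Module.End F V)
    (hT : ∀ i j, Commute (T i) (T j)) (a : ι → F) {W : Submodule F V}
    (hW : ∀ i, W ≤ W.comap (T i))
    (h : ∃ q : V ⧸ W, q ≠ 0 ∧ ∀ i, W.mapQ W (T i) (hW i) q = a i • q) :
    ∃ u : V, u ≠ 0 ∧ ∀ i, T i u = a i • u := by
  obtain ⟨q, hq0, hq⟩ := h
  obtain ⟨v, rfl⟩ := Submodule.Quotient.mk_surjective W q
  refine exists_forall_apply_eq_smul_of_forall_sub_smul_mem T hT a (fun i w hw => hW i hw)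
    ⟨v, fun hv => hq0 ((Submodule.Quotient.mk_eq_zero W).2 hv), fun i => ?_⟩
  have h1 := hq i
  rw [Submodule.mapQ_apply, ← Submodule.Quotient.mk_smul, Submodule.Quotient.eq] at h1
  exact h1

end Lifting


/-! ### Lifting along exact sequences -/

section Exact

variable {F : Type*} [Field F]
variable {V₁ V₂ V₃ : Type*} [AddCommGroup V₁] [Module F V₁] [AddCommGroup V₂] [Module F V₂]
  [AddCommGroup V₃] [Module F V₃] [FiniteDimensional F V₁]
variable {ι : Type*}

/-- **Eigenvalue systems along an exact sequence** (the form used for long exact sequences in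
cohomology, e.g. [Ash2003, §3], Smith sequences): let `V₁ → V₂ → V₃` be `F`-linear maps exact at
`V₂` (Mathlib `Function.Exact f g`), equivariant for families of endomorphisms `T₁, T₂, T₃`
(`f ∘ T₁ i = T₂ i ∘ f`, `g ∘ T₂ i = T₃ i ∘ g`), with `V₁` finite-dimensional and the `T₁ i` pairwise
commuting.  If a system of eigenvalues `a` occurs in `V₂`, then it occurs in `V₁` or in `V₃`: an
eigenvector `v₂` with `g v₂ ≠ 0` gives one in `V₃`; otherwise `v₂ = f v₁` and `a` occurs in
`V₁ / ker f`, hence in `V₁` by the lifting lemma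
`exists_forall_apply_eq_smul_of_forall_sub_smul_mem`. [folklore] -/
theorem exists_forall_apply_eq_smul_of_exact {f : V₁ →ₗ[F] V₂} {g : V₂ →ₗ[F] V₃}
    (hfg : Function.Exact f g) (T₁ : ι → Module.End F V₁) (T₂ : ι → Module.End F V₂)
    (T₃ : ι → Module.End F V₃) (h₁₂ : ∀ i, f ∘ₗ T₁ i = T₂ i ∘ₗ f)
    (h₂₃ : ∀ i, g ∘ₗ T₂ i = T₃ i ∘ₗ g) (hT₁ : ∀ i j, Commute (T₁ i) (T₁ j)) (a : ι → F)
    (h : ∃ v₂ : V₂, v₂ ≠ 0 ∧ ∀ i, T₂ i v₂ = a i • v₂) :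
    (∃ v₁ : V₁, v₁ ≠ 0 ∧ ∀ i, T₁ i v₁ = a i • v₁) ∨
      (∃ v₃ : V₃, v₃ ≠ 0 ∧ ∀ i, T₃ i v₃ = a i • v₃) := by
  obtain ⟨v₂, hv₂, hv⟩ := h
  by_cases hg : g v₂ = 0
  · -- `v₂ = f v₁`: the system occurs in `V₁ / ker f`
    left
    obtain ⟨v₁, rfl⟩ : v₂ ∈ Set.range f := (hfg v₂).1 hg
    refine exists_forall_apply_eq_smul_of_forall_sub_smul_mem T₁ hT₁ a (W := LinearMap.ker f)
      (fun i w hw => ?_) ⟨v₁, fun hv₁ => hv₂ ?_, fun i => ?_⟩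
    · rw [LinearMap.mem_ker] at hw ⊢
      rw [← LinearMap.comp_apply, h₁₂ i, LinearMap.comp_apply, hw, map_zero]
    · exact (LinearMap.mem_ker.1 hv₁)
    · rw [LinearMap.mem_ker, map_sub, map_smul, ← LinearMap.comp_apply, h₁₂ i, LinearMap.comp_apply,
        hv i, sub_self]
  · -- `g v₂` is an eigenvector in `V₃`
    right
    refine ⟨g v₂, hg, fun i => ?_⟩
    rw [← LinearMap.comp_apply, ← h₂₃ i, LinearMap.comp_apply, hv i, map_smul]

end Exact

end Literature.LinearAlgebra
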